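import Summits.CriticalPhenomena.PercolationContinuityZ3.Theorems.PercNearOneGluingNoHeavyLowerTailSahiCddPivot
import HarnessLib

/-!
# cdd theorem, part 2/4: the ANTITHETIC TOWER LEMMA and the reduction identity (†)

Support file (prover prim-ineq-prove-3 gen 13; `--supports stmt-CriticalPhenomena-4575`; memo FINDING-G13-CDD-THEOREM.md §3, §4(†)).
No definitions, no named facts, no sorries.  With `P_K` = `cddP` (the antithetic tower functional of `…SahiCddDefs`):
* bookkeeping for frozen sections `sec K x f` under insertion/deletion of a coordinate;
* `cddP_tower` — **TOWER LEMMA**: for `e ∉ F ∪ K`,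
  `P_K(f,g) = p_e²·P_K(f¹,g¹) + q_e²·P_K(f⁰,g⁰) + p_e q_e·P_{K∪{e}}(f,g)`  (`f¹ = f(insert e ·)`, `f⁰ = f(· ∖ e)`):
  pivoting a free coordinate produces the SAME functional one antithetic level up — this is what makes an induction on free
  coordinates possible although the naive `E₃`-only induction fails;
* `cddP_insert_eq` — **(†)** `P_{K∪{e}}(f,g) = P_K(f¹,g⁰) + P_K(f⁰,g¹) + Σ_{x⊆K} D(u^x v^x)`, `u^x = f^{x,1} − f^{x,0} ≥ 0`;
* `dep_insert`, `dep_sdiff`, `sec_const_off` — dependence-on-coordinates bookkeeping.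
-/

noncomputable section

namespace Summit.CriticalPhenomena.PercolationContinuityZ3.Theorems

namespace SahiCdd

open Literature.Combinatorics.Sahi2008
open Literature.Probability.Percolation.DecisionTree (ind ind_of_mem ind_of_not_mem ind_nonneg)
open Literature.Probability.Percolation.BHK2006 (weight weight_nonneg blockFubini harris)
open Literature.Probability.LatticeModels (prodBernoulli sahiE3 sahiE3_def)

variable {ι : Type*} [Fintype ι] [DecidableEq ι]

/-! ### Bookkeeping for frozen sections -/

omit [Fintype ι] in
/-- Freezing after deleting `e` = freezing in `insert e K` (pattern without `e`). [this work] -/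
theorem sec_insert_of_not_mem {K x : Finset ι} {e : ι} (hex : e ∉ x) (f : Set ι → ℝ) :
    sec (insert e K) x f = sec K x (fun ω => f (ω \ {e})) := by
  funext ω
  simp only [sec]
  congr 1
  ext i
  simp only [Set.mem_union, Set.mem_sdiff, Finset.coe_insert, Set.mem_insert_iff, Finset.mem_coe, Set.mem_singleton_iff]
  constructor
  · rintro (⟨h1, h2⟩ | h)
    · exact ⟨Or.inl ⟨h1, fun hk => h2 (Or.inr hk)⟩, fun hi => h2 (Or.inl hi)⟩
    · exact ⟨Or.inr h, fun hi => hex (hi ▸ h)⟩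
  · rintro ⟨⟨h1, h2⟩ | h, h3⟩
    · exact Or.inl ⟨h1, fun h' => h'.elim h3 h2⟩
    · exact Or.inr h

omit [Fintype ι] in
/-- Freezing after inserting `e` = freezing in `insert e K` (pattern with `e`). [this work] -/
theorem sec_insert_insert {K x : Finset ι} (e : ι) (f : Set ι → ℝ) :
    sec (insert e K) (insert e x) f = sec K x (fun ω => f (insert e ω)) := by
  funext ω
  simp only [sec]
  congr 1
  ext i
  simp only [Set.mem_union, Set.mem_sdiff, Finset.coe_insert, Set.mem_insert_iff, Finset.mem_coe]
  tauto

omit [Fintype ι] [DecidableEq ι] in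
/-- Inserting `e ∉ K` commutes with freezing the coordinates of `K`. [this work] -/
theorem sec_comp_insert {K x : Finset ι} {e : ι} (heK : e ∉ K) (f : Set ι → ℝ) :
    (fun ω => sec K x f (insert e ω)) = sec K x (fun ω => f (insert e ω)) := by
  funext ω
  simp only [sec]
  congr 1
  ext i
  simp only [Set.mem_union, Set.mem_sdiff, Set.mem_insert_iff, Finset.mem_coe]
  constructor
  · rintro (⟨h | h, h2⟩ | h)
    · exact Or.inl h
    · exact Or.inr (Or.inl ⟨h, h2⟩)
    · exact Or.inr (Or.inr h)
  · rintro (h | ⟨h, h2⟩ | h)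
    · exact Or.inl ⟨Or.inl h, fun hk => heK (h ▸ hk)⟩
    · exact Or.inl ⟨Or.inr h, h2⟩
    · exact Or.inr h

omit [Fintype ι] [DecidableEq ι] in
/-- Deleting `e ∉ x` commutes with freezing the coordinates of `K` to `x`. [this work] -/
theorem sec_comp_sdiff {K x : Finset ι} {e : ι} (hex : e ∉ x) (f : Set ι → ℝ) :
    (fun ω => sec K x f (ω \ {e})) = sec K x (fun ω => f (ω \ {e})) := by
  funext ω
  simp only [sec]
  congr 1
  ext i
  simp only [Set.mem_union, Set.mem_sdiff, Set.mem_singleton_iff, Finset.mem_coe]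
  constructor
  · rintro (⟨⟨h1, h2⟩, h3⟩ | h)
    · exact ⟨Or.inl ⟨h1, h3⟩, h2⟩
    · exact ⟨Or.inr h, fun hi => hex (hi ▸ h)⟩
  · rintro ⟨⟨h1, h3⟩ | h, h2⟩
    · exact Or.inl ⟨⟨h1, h2⟩, h3⟩
    · exact Or.inr h

omit [Fintype ι] [DecidableEq ι] in
/-- Pointwise form of `sec_comp_insert`. [this work] -/
theorem sec_apply_insert {K x : Finset ι} {e : ι} (heK : e ∉ K) (f : Set ι → ℝ) (ω : Set ι) :
    sec K x f (insert e ω) = sec K x (fun ω => f (insert e ω)) ω := by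
  rw [← sec_comp_insert heK f]

omit [Fintype ι] [DecidableEq ι] in
/-- Pointwise form of `sec_comp_sdiff`. [this work] -/
theorem sec_apply_sdiff {K x : Finset ι} {e : ι} (hex : e ∉ x) (f : Set ι → ℝ) (ω : Set ι) :
    sec K x f (ω \ {e}) = sec K x (fun ω => f (ω \ {e})) ω := by
  rw [← sec_comp_sdiff hex f]

/-! ### The tower lemma -/

/-- **TOWER LEMMA.**  For `e ∉ F ∪ K`:
`P_K(f,g) = p_e² P_K(f¹,g¹) + q_e² P_K(f⁰,g⁰) + p_e q_e P_{K ∪ {e}}(f,g)` (`f¹ = f(insert e ·)`, `f⁰ = f(· ∖ {e})`). [this work] -/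
theorem cddP_tower (p : ι → unitInterval) {F K : Finset ι} {e : ι} (he : e ∉ F) (heK : e ∉ K)
    (f g : Set ι → ℝ) :
    cddP p F K f g =
      (p e : ℝ) ^ 2 * cddP p F K (fun ω => f (insert e ω)) (fun ω => g (insert e ω))
      + (1 - p e) ^ 2 * cddP p F K (fun ω => f (ω \ {e})) (fun ω => g (ω \ {e}))
      + (p e : ℝ) * (1 - p e) * cddP p F (insert e K) f g := by
  unfold cddP
  -- the powerset of `insert e K`
  have hdisj : Disjoint K.powerset (K.powerset.image (insert e)) := by
    rw [Finset.disjoint_left]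
    intro x hx hx'
    obtain ⟨y, -, rfl⟩ := Finset.mem_image.1 hx'
    exact heK (Finset.mem_powerset.1 hx (Finset.mem_insert_self e y))
  have hinj : Set.InjOn (insert e) (K.powerset : Set (Finset ι)) := by
    intro x hx y hy hxy
    have hxe : e ∉ x := fun h => heK (Finset.mem_powerset.1 (Finset.mem_coe.1 hx) h)
    have hye : e ∉ y := fun h => heK (Finset.mem_powerset.1 (Finset.mem_coe.1 hy) h)
    rw [← Finset.erase_insert hxe, hxy, Finset.erase_insert hye]
  rw [Finset.powerset_insert, Finset.sum_union hdisj, Finset.sum_image hinj]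
  rw [Finset.mul_sum, Finset.mul_sum, mul_add, Finset.mul_sum, Finset.mul_sum, ← Finset.sum_add_distrib,
    ← Finset.sum_add_distrib, ← Finset.sum_add_distrib]
  refine Finset.sum_congr rfl fun x hx => ?_
  have hxK : x ⊆ K := Finset.mem_powerset.1 hx
  have hex : e ∉ x := fun h => heK (hxK h)
  have heKx : e ∉ K \ x := fun h => heK (Finset.sdiff_subset h)
  -- complements inside `insert e K`
  have hc1 : insert e K \ x = insert e (K \ x) := Finset.insert_sdiff_of_notMem K hex
  have hc2 : insert e K \ insert e x = K \ x := by
    ext i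
    simp only [Finset.mem_sdiff, Finset.mem_insert]
    constructor
    · rintro ⟨h | h, h2⟩
      · exact absurd (Or.inl h) h2
      · exact ⟨h, fun h3 => h2 (Or.inr h3)⟩
    · rintro ⟨h1, h2⟩
      exact ⟨Or.inr h1, fun h3 => h3.elim (fun h4 => heK (h4 ▸ h1)) h2⟩
  rw [hc1, hc2, sec_insert_of_not_mem hex f, sec_insert_of_not_mem hex g, sec_insert_insert e f,
    sec_insert_insert e g, sec_insert_of_not_mem heKx g, sec_insert_insert e g]
  -- pivot the level-`K` terms
  rw [cddT_pivot p he (sec K x f) (sec K (K \ x) g),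
    cddD_pivot p he (sec K x f * (sec K x g - sec K (K \ x) g))]
  -- normalise the section functions of the pivoted `T`-terms
  rw [sec_comp_insert heK f, sec_comp_sdiff hex f, sec_comp_insert heK g, sec_comp_sdiff heKx g]
  -- normalise the arguments of the `D`-terms to pointwise lambdas
  simp only [Pi.mul_apply, Pi.mul_def, Pi.sub_def]
  simp only [sec_apply_insert heK, sec_apply_sdiff hex, sec_apply_sdiff heKx]
  -- expand every `D` into `ex`-atoms and close by linear algebra
  rw [cddD_sub_mul_sub]
  simp only [cddD_mul_sub]
  ring


/-! ### The reduction identity (†) on which the base-case induction runs -/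

/-- **(†)**: `P_{K∪{e}}(f,g) = P_K(f¹,g⁰) + P_K(f⁰,g¹) + Σ_{x⊆K} D(u^x v^x)` with `u^x = f^{x,1} − f^{x,0}`, `v^x = g^{x,1} − g^{x,0}`
(`e ∉ K`; pure bilinear algebra). [this work] -/
theorem cddP_insert_eq (p : ι → unitInterval) (F : Finset ι) {K : Finset ι} {e : ι} (heK : e ∉ K)
    (f g : Set ι → ℝ) :
    cddP p F (insert e K) f g =
      cddP p F K (fun ω => f (insert e ω)) (fun ω => g (ω \ {e}))
      + cddP p F K (fun ω => f (ω \ {e})) (fun ω => g (insert e ω))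
      + ∑ x ∈ K.powerset, cddD p F (fun ω =>
          (sec K x (fun ω => f (insert e ω)) ω - sec K x (fun ω => f (ω \ {e})) ω) *
            (sec K x (fun ω => g (insert e ω)) ω - sec K x (fun ω => g (ω \ {e})) ω)) := by
  unfold cddP
  have hdisj : Disjoint K.powerset (K.powerset.image (insert e)) := by
    rw [Finset.disjoint_left]
    intro x hx hx'
    obtain ⟨y, -, rfl⟩ := Finset.mem_image.1 hx'
    exact heK (Finset.mem_powerset.1 hx (Finset.mem_insert_self e y))
  have hinj : Set.InjOn (insert e) (K.powerset : Set (Finset ι)) := by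
    intro x hx y hy hxy
    have hxe : e ∉ x := fun h => heK (Finset.mem_powerset.1 (Finset.mem_coe.1 hx) h)
    have hye : e ∉ y := fun h => heK (Finset.mem_powerset.1 (Finset.mem_coe.1 hy) h)
    rw [← Finset.erase_insert hxe, hxy, Finset.erase_insert hye]
  rw [Finset.powerset_insert, Finset.sum_union hdisj, Finset.sum_image hinj, ← Finset.sum_add_distrib,
    ← Finset.sum_add_distrib, ← Finset.sum_add_distrib]
  refine Finset.sum_congr rfl fun x hx => ?_
  have hxK : x ⊆ K := Finset.mem_powerset.1 hx
  have hex : e ∉ x := fun h => heK (hxK h)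
  have heKx : e ∉ K \ x := fun h => heK (Finset.sdiff_subset h)
  have hc1 : insert e K \ x = insert e (K \ x) := Finset.insert_sdiff_of_notMem K hex
  have hc2 : insert e K \ insert e x = K \ x := by
    ext i
    simp only [Finset.mem_sdiff, Finset.mem_insert]
    constructor
    · rintro ⟨h | h, h2⟩
      · exact absurd (Or.inl h) h2
      · exact ⟨h, fun h3 => h2 (Or.inr h3)⟩
    · rintro ⟨h1, h2⟩
      exact ⟨Or.inr h1, fun h3 => h3.elim (fun h4 => heK (h4 ▸ h1)) h2⟩
  rw [hc1, hc2, sec_insert_of_not_mem hex f, sec_insert_of_not_mem hex g, sec_insert_insert e f,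
    sec_insert_insert e g, sec_insert_of_not_mem heKx g, sec_insert_insert e g]
  simp only [Pi.mul_def, Pi.sub_def]
  rw [cddD_sub_mul_sub]
  simp only [cddD_mul_sub]
  ring

/-! ### Dependence on a set of coordinates -/

omit [Fintype ι] [DecidableEq ι] in
/-- If `f` depends only on the coordinates in `S` and `S ∖ {e} ⊆ S'`, then `f(insert e ·)` depends only on `S'`. [folklore] -/
theorem dep_insert {f : Set ι → ℝ} {S S' : Set ι} (hf : ∀ ω, f ω = f (ω ∩ S)) {e : ι} (hS : S \ {e} ⊆ S') :
    ∀ ω, (fun ω => f (insert e ω)) ω = (fun ω => f (insert e ω)) (ω ∩ S') := by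
  intro ω
  simp only
  rw [hf (insert e ω), hf (insert e (ω ∩ S'))]
  congr 1
  ext i
  simp only [Set.mem_inter_iff, Set.mem_insert_iff]
  constructor
  · rintro ⟨h | h, hS'⟩
    · exact ⟨Or.inl h, hS'⟩
    · by_cases hie : i = e
      · exact ⟨Or.inl hie, hS'⟩
      · exact ⟨Or.inr ⟨h, hS ⟨hS', hie⟩⟩, hS'⟩
  · rintro ⟨h | ⟨h, -⟩, hS'⟩
    · exact ⟨Or.inl h, hS'⟩
    · exact ⟨Or.inr h, hS'⟩

omit [Fintype ι] [DecidableEq ι] in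
/-- If `f` depends only on the coordinates in `S` and `S ∖ {e} ⊆ S'`, then `f(· ∖ {e})` depends only on `S'`. [folklore] -/
theorem dep_sdiff {f : Set ι → ℝ} {S S' : Set ι} (hf : ∀ ω, f ω = f (ω ∩ S)) {e : ι} (hS : S \ {e} ⊆ S') :
    ∀ ω, (fun ω => f (ω \ {e})) ω = (fun ω => f (ω \ {e})) (ω ∩ S') := by
  intro ω
  simp only
  rw [hf (ω \ {e}), hf ((ω ∩ S') \ {e})]
  congr 1
  ext i
  simp only [Set.mem_inter_iff, Set.mem_sdiff, Set.mem_singleton_iff]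
  constructor
  · rintro ⟨⟨h, hie⟩, hS'⟩
    exact ⟨⟨⟨h, hS ⟨hS', hie⟩⟩, hie⟩, hS'⟩
  · rintro ⟨⟨⟨h, -⟩, hie⟩, hS'⟩
    exact ⟨⟨h, hie⟩, hS'⟩

omit [Fintype ι] [DecidableEq ι] in
/-- In the base setting (`f` depends only on `F ∪ K`), every frozen section `sec K x f` is constant off the OR event. [this work] -/
theorem sec_const_off {F K : Finset ι} (x : Finset ι) {f : Set ι → ℝ} (hf : ∀ ω, f ω = f (ω ∩ ((F : Set ι) ∪ (K : Set ι)))) :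
    ∀ ω, ω ∉ orEvent F → sec K x f ω = sec K x f ∅ := by
  intro ω hω
  simp only [sec]
  rw [hf (ω \ (K : Set ι) ∪ (x : Set ι)), hf (∅ \ (K : Set ι) ∪ (x : Set ι))]
  congr 1
  ext i
  simp only [Set.mem_inter_iff, Set.mem_union, Set.mem_sdiff, Finset.mem_coe, Set.empty_sdiff, Set.mem_empty_iff_false,
    false_or]
  constructor
  · rintro ⟨⟨hiω, hiK⟩ | hix, hFK⟩
    · rcases hFK with hiF | hiK'
      · exact absurd (show ω ∈ orEvent F from ⟨i, hiF, hiω⟩) hω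
      · exact absurd hiK' hiK
    · exact ⟨hix, hFK⟩
  · rintro ⟨hix, hFK⟩
    exact ⟨Or.inr hix, hFK⟩

end SahiCdd

end Summit.CriticalPhenomena.PercolationContinuityZ3.Theorems
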